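import Summits.SmoothPoincare4.SmoothPoincare4.Theorems.ConvexBisectionAcyclicBisectionExistsHurwitzMoveAngles
import Literature.GroupTheory.CombinatorialGroupTheory.SignedHurwitzAction
import HarnessLib

/-!
# The adjacent swap of a Lefschetz link from three drags of one handle (N1-swap from N1-move)
(wave 6, brick of stub `stub_M2geo` = node N1 of NF4, line `modp-braid-orbits`, crux
`ConvexBisection.AcyclicBisectionExists`, item stmt-SmoothPoincare4-10508; registered sub-goal
`helper_norm_update_dir`)

`swap_of_move`: the geometric node N1-move of the N1 design (`N1_HurwitzMove_Design.lean`, G4;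
hypothesis `hmove`: ONE handle `k₀` of a generalised Lefschetz link on fibred data — directions
`d`, shadows `v`, twistings coded by `s`, seam and belt clauses phrased through the accumulated
diffeomorphism `G₀ : X₀ ≅ X` — dragged by a signed angle `φ` through a sector of pages free of
other handles except possibly ONE crossed handle `k₁`, with output the new piece `X'`, family `h'`,
data `D'`, `G : X ≅ X'`, the class `transvection (v k₁, s k₁)` resp. `(v k₁, ¬ s k₁)` of the moved
handle for a counter-clockwise resp. clockwise crossing, and the two clauses through `G₀ ≫ G` for
the updated directions; Gompf–Stipsicz 1999 §8.2 on Kas' handlebody) implies the adjacent swap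
N1-swap consumed by `transfer_of_swap` (`…HurwitzMoveTransfer.lean`): three drags (cross, free,
free) chained through `refl ≫ G₁ ≫ G₂ ≫ G₃`, directions by `Function.update`, classes by
`Option.elim`, the arcs free by `…HurwitzMoveAngles.lean`.  With the tree:
`stub_M2geo := m2geo_of_transfer (transfer_of_swap (swap_of_move node_N1_move))` and
(HS) `:= hurwitzStep_of_redecomposition (transfer_of_swap (swap_of_move node_N1_move))`.
Everything here is proved; no named facts, no `sorry`.  Reference: R. E. Gompf, A. I. Stipsicz,
*4-Manifolds and Kirby Calculus* (1999), §8.2 [GompfStipsicz1999].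
-/

noncomputable section

set_option linter.dupNamespace false

open scoped Manifold ContDiff Topology Real
open Set Function

namespace Summit.SmoothPoincare4.SmoothPoincare4.Theorems.AcyclicBisectionExists.ModpBraidOrbits

open Literature.GroupTheory.CombinatorialGroupTheory.SignedHurwitz
open Literature.Topology.FourManifolds Literature.Topology.FourManifolds.LefschetzBase
open Literature.Topology.FourManifolds.HandleAttachingMap
open HurwitzMove

/-- **N1-swap from N1-move**: the two adjacent handles `i`, `i+1` exchanged (transfer form, old
indices) by three drags of one handle — see the module docstring. [cite: GompfStipsicz1999, §8.2] -/
theorem swap_of_move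
    (hmove :
      ∀ (g n : ℕ) (X₀ : Type) [TopologicalSpace X₀] [T2Space X₀] [SecondCountableTopology X₀]
        [CompactSpace X₀] [ChartedSpace (EuclideanHalfSpace 4) X₀] [IsManifold (𝓡∂ 4) ∞ X₀]
        (bX : BoundaryData (𝓡∂ 4) X₀ (𝓡 3)) (Ψ : bX.carrier ≃ₘ⟮𝓡 3, 𝓡 3⟯ (bBase g).carrier)
        (X : Type) [TopologicalSpace X] [T2Space X] [SecondCountableTopology X] [CompactSpace X]
        [ChartedSpace (EuclideanHalfSpace 4) X] [IsManifold (𝓡∂ 4) ∞ X]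
        (G₀ : X₀ ≃ₘ⟮𝓡∂ 4, 𝓡∂ 4⟯ X)
        (h : Fin n → HandleAttachingMap 3 2 (Base g)) (D : MultiAttachmentData h (𝓡∂ 4) X)
        (d : Fin n → ℂ) (v : Fin n → (Fin g ⊕ Fin g → ℤ)) (s : Fin n → Bool),
        (∀ k, ‖d k‖ = 1) →
        (∀ k θ, (h k).attachingCircle θ ∈ page g (d k)) →
        (∀ k, shadow g (h k).attachingCircle (h k).continuous_attachingCircle = v k) →
        (∀ k, pageTwisting g (h k).attachingCircle (h k).attachingFraming = if s k then -1 else 1) →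
        (∀ (y : bX.carrier) (a : ↥(coresComplement h)), G₀ (bX.incl y) = D.jA a →
          ∃ c : ℝ, 0 < c ∧ w g ((bBase g).incl (Ψ y)).1 = (c : ℂ) * w g (a : Base g).1) →
        (∀ (y : bX.carrier) (k : Fin n) (b : ↥(beltPiece 3 2)), G₀ (bX.incl y) = D.jB k b →
          G₀ (bX.incl y) ∉ range D.jA →
          ∃ c : ℝ, 0 < c ∧ w g ((bBase g).incl (Ψ y)).1 = (c : ℂ) * d k) →
        ∀ (k₀ : Fin n) (φ : ℝ) (cross : Option (Fin n)), φ ≠ 0 → |φ| < 2 * π →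
        (∀ k, k ≠ k₀ → cross ≠ some k → ∀ t ∈ Set.Icc (0 : ℝ) 1,
          d k ≠ d k₀ * Complex.exp (((t * φ : ℝ) : ℂ) * Complex.I)) →
        (∀ k₁, cross = some k₁ → k₁ ≠ k₀ ∧
          (∃ t ∈ Set.Ioo (0 : ℝ) 1, d k₁ = d k₀ * Complex.exp (((t * φ : ℝ) : ℂ) * Complex.I))) →
        ∃ (X' : Type) (_ : TopologicalSpace X') (_ : T2Space X') (_ : SecondCountableTopology X')
          (_ : CompactSpace X') (_ : ChartedSpace (EuclideanHalfSpace 4) X')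
          (_ : IsManifold (𝓡∂ 4) ∞ X') (h' : Fin n → HandleAttachingMap 3 2 (Base g))
          (D' : MultiAttachmentData h' (𝓡∂ 4) X') (G : X ≃ₘ⟮𝓡∂ 4, 𝓡∂ 4⟯ X'),
          (∀ k θ, (h' k).attachingCircle θ ∈
            page g (Function.update d k₀ (d k₀ * Complex.exp ((φ : ℂ) * Complex.I)) k)) ∧
          (∀ k, shadow g (h' k).attachingCircle (h' k).continuous_attachingCircle =
            Function.update v k₀ (Option.elim cross (v k₀)
              (fun k₁ => transvection (stdSymp ℤ g) (v k₁, if 0 < φ then s k₁ else !s k₁) (v k₀))) k) ∧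
          (∀ k, pageTwisting g (h' k).attachingCircle (h' k).attachingFraming = (if s k then -1 else 1)) ∧
          (∀ (y : bX.carrier) (a' : ↥(coresComplement h')), (G₀.trans G) (bX.incl y) = D'.jA a' →
            ∃ c : ℝ, 0 < c ∧ w g ((bBase g).incl (Ψ y)).1 = (c : ℂ) * w g (a' : Base g).1) ∧
          (∀ (y : bX.carrier) (k : Fin n) (b : ↥(beltPiece 3 2)), (G₀.trans G) (bX.incl y) = D'.jB k b →
            (G₀.trans G) (bX.incl y) ∉ range D'.jA →
            ∃ c : ℝ, 0 < c ∧ w g ((bBase g).incl (Ψ y)).1 =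
              (c : ℂ) * Function.update d k₀ (d k₀ * Complex.exp ((φ : ℂ) * Complex.I)) k)) :
    ∀ (g n : ℕ) (X : Type) [TopologicalSpace X] [T2Space X] [SecondCountableTopology X]
      [CompactSpace X] [ChartedSpace (EuclideanHalfSpace 4) X] [IsManifold (𝓡∂ 4) ∞ X]
      (h : Fin n → HandleAttachingMap 3 2 (Base g)) (D : MultiAttachmentData h (𝓡∂ 4) X)
      (bX : BoundaryData (𝓡∂ 4) X (𝓡 3)) (Ψ : bX.carrier ≃ₘ⟮𝓡 3, 𝓡 3⟯ (bBase g).carrier)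
      (v : Fin n → (Fin g ⊕ Fin g → ℤ)) (s : Fin n → Bool),
      (∀ (k : Fin n) θ, (h k).attachingCircle θ ∈ page g (pageDir n k)) →
      (∀ k, shadow g (h k).attachingCircle (h k).continuous_attachingCircle = v k) →
      (∀ k, pageTwisting g (h k).attachingCircle (h k).attachingFraming = if s k then -1 else 1) →
      (∀ (y : bX.carrier) (a : ↥(coresComplement h)), bX.incl y = D.jA a →
        ∃ c : ℝ, 0 < c ∧ w g ((bBase g).incl (Ψ y)).1 = (c : ℂ) * w g (a : Base g).1) →
      (∀ (y : bX.carrier) (k : Fin n) (b : ↥(beltPiece 3 2)), bX.incl y = D.jB k b →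
        bX.incl y ∉ range D.jA →
        ∃ c : ℝ, 0 < c ∧ w g ((bBase g).incl (Ψ y)).1 = (c : ℂ) * pageDir n k) →
      ∀ (i : ℕ) (hi : i + 1 < n) (up : Bool),
      ∃ (X' : Type) (_ : TopologicalSpace X') (_ : T2Space X') (_ : SecondCountableTopology X')
        (_ : CompactSpace X') (_ : ChartedSpace (EuclideanHalfSpace 4) X')
        (_ : IsManifold (𝓡∂ 4) ∞ X') (h' : Fin n → HandleAttachingMap 3 2 (Base g))
        (D' : MultiAttachmentData h' (𝓡∂ 4) X') (G : X ≃ₘ⟮𝓡∂ 4, 𝓡∂ 4⟯ X'),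
        (∀ k : Fin n, k.1 ≠ i → k.1 ≠ i + 1 → ∀ θ, (h' k).attachingCircle θ ∈ page g (pageDir n k)) ∧
        (∀ θ, (h' ⟨i + 1, hi⟩).attachingCircle θ ∈ page g (pageDir n i)) ∧
        (∀ θ, (h' ⟨i, Nat.lt_of_succ_lt hi⟩).attachingCircle θ ∈ page g (pageDir n (i + 1))) ∧
        (∀ k : Fin n, k.1 ≠ i → k.1 ≠ i + 1 →
          shadow g (h' k).attachingCircle (h' k).continuous_attachingCircle = v k) ∧
        shadow g (h' ⟨i + 1, hi⟩).attachingCircle (h' ⟨i + 1, hi⟩).continuous_attachingCircle =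
          (if up then transvection (stdSymp ℤ g) (v ⟨i, Nat.lt_of_succ_lt hi⟩, s ⟨i, Nat.lt_of_succ_lt hi⟩)
            (v ⟨i + 1, hi⟩) else v ⟨i + 1, hi⟩) ∧
        shadow g (h' ⟨i, Nat.lt_of_succ_lt hi⟩).attachingCircle
            (h' ⟨i, Nat.lt_of_succ_lt hi⟩).continuous_attachingCircle =
          (if up then v ⟨i, Nat.lt_of_succ_lt hi⟩ else
            transvection (stdSymp ℤ g) (v ⟨i + 1, hi⟩, !s ⟨i + 1, hi⟩) (v ⟨i, Nat.lt_of_succ_lt hi⟩)) ∧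
        (∀ k : Fin n, pageTwisting g (h' k).attachingCircle (h' k).attachingFraming = if s k then -1 else 1) ∧
        (∀ (y : bX.carrier) (a' : ↥(coresComplement h')), G (bX.incl y) = D'.jA a' →
          ∃ c : ℝ, 0 < c ∧ w g ((bBase g).incl (Ψ y)).1 = (c : ℂ) * w g (a' : Base g).1) := by
  intro g n X _ _ _ _ _ _ h D bX Ψ v s hpage_k hshadow htw hseam hbelt i hi up
  have hiA : i < n := Nat.lt_of_succ_lt hi
  have hn2 : 2 ≤ n := by omega
  have hn2r : (2 : ℝ) ≤ n := by exact_mod_cast hn2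
  have hnpos : (0 : ℝ) < n := by linarith
  have hAB : (⟨i, hiA⟩ : Fin n) ≠ ⟨i + 1, hi⟩ := fun c => by simp [Fin.ext_iff] at c
  have hBA : (⟨i + 1, hi⟩ : Fin n) ≠ ⟨i, hiA⟩ := fun c => hAB c.symm
  -- the invariants through `refl`
  have hseam0 : ∀ (y : bX.carrier) (a : ↥(coresComplement h)),
      (Diffeomorph.refl (𝓡∂ 4) X ∞) (bX.incl y) = D.jA a →
      ∃ c : ℝ, 0 < c ∧ w g ((bBase g).incl (Ψ y)).1 = (c : ℂ) * w g (a : Base g).1 :=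
    fun y a hy => hseam y a hy
  have hbelt0 : ∀ (y : bX.carrier) (k : Fin n) (b : ↥(beltPiece 3 2)),
      (Diffeomorph.refl (𝓡∂ 4) X ∞) (bX.incl y) = D.jB k b →
      (Diffeomorph.refl (𝓡∂ 4) X ∞) (bX.incl y) ∉ range D.jA →
      ∃ c : ℝ, 0 < c ∧ w g ((bBase g).incl (Ψ y)).1 = (c : ℂ) * (fun k : Fin n => pageDir n ↑k) k :=
    fun y k b hy hd => hbelt y k b hy hd
  cases up with
  | true =>
    -- MOVE 1: handle ⟨i + 1, hi⟩ dragged by `3 * π / n` across handle ⟨i, hiA⟩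
    have hφ₁ : (3 * π / n : ℝ) ≠ 0 := (by positivity : (0 : ℝ) < 3 * π / n).ne'
    have hφ₁' : |(3 * π / n : ℝ)| < 2 * π := by
      rw [abs_of_pos (by positivity), div_lt_iff₀ hnpos]; nlinarith [Real.pi_pos, hn2r]
    have hφ₁pos : (0 : ℝ) < 3 * π / n := by positivity
    obtain ⟨X₁, _, _, _, _, _, _, h₁, D₁, G₁, hpg₁, hsh₁, htw₁, hseam₁, hbelt₁⟩ :=
      hmove g n X bX Ψ X (Diffeomorph.refl (𝓡∂ 4) X ∞) h D (fun k : Fin n => pageDir n ↑k) v s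
        (fun k => norm_pageDir n k) hpage_k hshadow htw hseam0 hbelt0 ⟨i + 1, hi⟩ (3 * π / n)
        (some ⟨i, hiA⟩) hφ₁ hφ₁'
        (fun k hk0 hkc t ht heq => free_move1 hi k hk0 (fun c => hkc (by rw [c])) ht heq)
        (fun k₁ hk₁ => by
          obtain rfl : (⟨i, hiA⟩ : Fin n) = k₁ := Option.some_injective _ hk₁
          exact ⟨hAB, 2 / 3, ⟨by norm_num, by norm_num⟩, cross_move1 hi⟩)
    have hd₁ : ∀ k, ‖Function.update (fun k : Fin n => pageDir n ↑k) ⟨i + 1, hi⟩ (pageDir n (i + 1) * Complex.exp (((3 * π / n : ℝ) : ℂ) * Complex.I)) k‖ = 1 := by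
      intro k
      by_cases hk : k = ⟨i + 1, hi⟩
      · subst hk
        rw [Function.update_self, norm_mul, norm_pageDir, Complex.norm_exp_ofReal_mul_I, mul_one]
      · rw [Function.update_of_ne hk, norm_pageDir]
    have hshadows₁ : ∀ k, shadow g (h₁ k).attachingCircle (h₁ k).continuous_attachingCircle = Function.update v ⟨i + 1, hi⟩ (transvection (stdSymp ℤ g) (v ⟨i, hiA⟩, s ⟨i, hiA⟩) (v ⟨i + 1, hi⟩)) k := by
      intro k; rw [hsh₁ k]; simp only [Option.elim_some, if_pos hφ₁pos]
    -- MOVE 2: handle ⟨i, hiA⟩ rotated freely by `-(2 * π / n)`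
    have hφ₂ : (-(2 * π / n) : ℝ) ≠ 0 := neg_ne_zero.2 (by positivity : (0 : ℝ) < 2 * π / n).ne'
    have hφ₂' : |(-(2 * π / n) : ℝ)| < 2 * π := by
      rw [abs_neg, abs_of_pos (by positivity), div_lt_iff₀ hnpos]; nlinarith [Real.pi_pos, hn2r]
    obtain ⟨X₂, _, _, _, _, _, _, h₂, D₂, G₂, hpg₂, hsh₂, htw₂, hseam₂, hbelt₂⟩ :=
      hmove g n X bX Ψ X₁ ((Diffeomorph.refl (𝓡∂ 4) X ∞).trans G₁) h₁ D₁
        (Function.update (fun k : Fin n => pageDir n ↑k) ⟨i + 1, hi⟩ (pageDir n (i + 1) * Complex.exp (((3 * π / n : ℝ) : ℂ) * Complex.I))) (Function.update v ⟨i + 1, hi⟩ (transvection (stdSymp ℤ g) (v ⟨i, hiA⟩, s ⟨i, hiA⟩) (v ⟨i + 1, hi⟩))) s hd₁ hpg₁ hshadows₁ htw₁ hseam₁ hbelt₁ ⟨i, hiA⟩ (-(2 * π / n)) none hφ₂ hφ₂'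
        (fun k hk0 _ t ht heq => by
          rw [Function.update_of_ne hAB] at heq
          by_cases hk : k = ⟨i + 1, hi⟩
          · subst hk
            rw [Function.update_self] at heq
            exact free_move2_B hi ht heq
          · rw [Function.update_of_ne hk] at heq
            exact free_move2_O hi k hk hk0 ht heq)
        (fun k₁ hk₁ => (Option.some_ne_none k₁ hk₁.symm).elim)
    have hd₂ : ∀ k, ‖Function.update (Function.update (fun k : Fin n => pageDir n ↑k) ⟨i + 1, hi⟩ (pageDir n (i + 1) * Complex.exp (((3 * π / n : ℝ) : ℂ) * Complex.I))) ⟨i, hiA⟩ ((Function.update (fun k : Fin n => pageDir n ↑k) ⟨i + 1, hi⟩ (pageDir n (i + 1) * Complex.exp (((3 * π / n : ℝ) : ℂ) * Complex.I))) ⟨i, hiA⟩ * Complex.exp (((-(2 * π / n) : ℝ) : ℂ) * Complex.I)) k‖ = 1 := by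
      intro k
      by_cases hk : k = ⟨i, hiA⟩
      · subst hk
        rw [Function.update_self, norm_mul, hd₁, Complex.norm_exp_ofReal_mul_I, mul_one]
      · rw [Function.update_of_ne hk]
        exact hd₁ k
    have hshadows₂ : ∀ k, shadow g (h₂ k).attachingCircle (h₂ k).continuous_attachingCircle = Function.update v ⟨i + 1, hi⟩ (transvection (stdSymp ℤ g) (v ⟨i, hiA⟩, s ⟨i, hiA⟩) (v ⟨i + 1, hi⟩)) k := by
      intro k; rw [hsh₂ k, Option.elim_none, Function.update_eq_self]
    -- MOVE 3: handle ⟨i + 1, hi⟩ rotated freely by `-(π / n)`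
    have hφ₃ : (-(π / n) : ℝ) ≠ 0 := neg_ne_zero.2 (by positivity : (0 : ℝ) < π / n).ne'
    have hφ₃' : |(-(π / n) : ℝ)| < 2 * π := by
      rw [abs_neg, abs_of_pos (by positivity), div_lt_iff₀ hnpos]; nlinarith [Real.pi_pos, hn2r]
    obtain ⟨X₃, _, _, _, _, _, _, h₃, D₃, G₃, hpg₃, hsh₃, htw₃, hseam₃, -⟩ :=
      hmove g n X bX Ψ X₂ (((Diffeomorph.refl (𝓡∂ 4) X ∞).trans G₁).trans G₂) h₂ D₂
        (Function.update (Function.update (fun k : Fin n => pageDir n ↑k) ⟨i + 1, hi⟩ (pageDir n (i + 1) * Complex.exp (((3 * π / n : ℝ) : ℂ) * Complex.I))) ⟨i, hiA⟩ ((Function.update (fun k : Fin n => pageDir n ↑k) ⟨i + 1, hi⟩ (pageDir n (i + 1) * Complex.exp (((3 * π / n : ℝ) : ℂ) * Complex.I))) ⟨i, hiA⟩ * Complex.exp (((-(2 * π / n) : ℝ) : ℂ) * Complex.I))) (Function.update v ⟨i + 1, hi⟩ (transvection (stdSymp ℤ g) (v ⟨i, hiA⟩, s ⟨i, hiA⟩)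 (v ⟨i + 1, hi⟩))) s hd₂ hpg₂ hshadows₂ htw₂ hseam₂ hbelt₂ ⟨i + 1, hi⟩ (-(π / n)) none hφ₃ hφ₃'
        (fun k hk0 _ t ht heq => by
          rw [Function.update_of_ne hBA, Function.update_self] at heq
          by_cases hk : k = ⟨i, hiA⟩
          · subst hk
            rw [Function.update_self, Function.update_of_ne hAB] at heq
            exact free_move3_A hi ht heq
          · rw [Function.update_of_ne hk, Function.update_of_ne hk0] at heq
            exact free_move3_O hi k hk0 hk ht heq)
        (fun k₁ hk₁ => (Option.some_ne_none k₁ hk₁.symm).elim)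
    -- OUTPUT
    refine ⟨X₃, ‹_›, ‹_›, ‹_›, ‹_›, ‹_›, ‹_›, h₃, D₃,
      ((((Diffeomorph.refl (𝓡∂ 4) X ∞).trans G₁).trans G₂).trans G₃), ?_, ?_, ?_, ?_, ?_, ?_, htw₃, hseam₃⟩
    · intro k h1 h2 θ
      have hkA : k ≠ ⟨i, hiA⟩ := fun c => h1 (congrArg Fin.val c)
      have hkB : k ≠ ⟨i + 1, hi⟩ := fun c => h2 (congrArg Fin.val c)
      have hm := hpg₃ k θ
      rw [Function.update_of_ne hkB, Function.update_of_ne hkA, Function.update_of_ne hkB] at hm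
      exact hm
    · intro θ
      have hm := hpg₃ ⟨i + 1, hi⟩ θ
      rw [Function.update_self, Function.update_of_ne hBA, Function.update_self, dir_move3 hi] at hm
      exact hm
    · intro θ
      have hm := hpg₃ ⟨i, hiA⟩ θ
      rw [Function.update_of_ne hAB, Function.update_self, Function.update_of_ne hAB] at hm
      have e := dir_move2 hi
      exact e ▸ hm
    · intro k h1 h2
      have hkB : k ≠ ⟨i + 1, hi⟩ := fun c => h2 (congrArg Fin.val c)
      rw [hsh₃ k, Option.elim_none, Function.update_eq_self, Function.update_of_ne hkB]
    · rw [hsh₃, Option.elim_none, Function.update_eq_self, Function.update_self, if_pos rfl]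
    · rw [hsh₃, Option.elim_none, Function.update_eq_self, Function.update_of_ne hAB, if_pos rfl]
  | false =>
    -- MOVE 1: handle ⟨i, hiA⟩ dragged by `-(3 * π / n)` across handle ⟨i + 1, hi⟩
    have hφ₁ : (-(3 * π / n) : ℝ) ≠ 0 := neg_ne_zero.2 (by positivity : (0 : ℝ) < 3 * π / n).ne'
    have hφ₁' : |(-(3 * π / n) : ℝ)| < 2 * π := by
      rw [abs_neg, abs_of_pos (by positivity), div_lt_iff₀ hnpos]; nlinarith [Real.pi_pos, hn2r]
    have hφ₁neg : ¬ (0 : ℝ) < -(3 * π / n) := by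
      have h3 : (0 : ℝ) < 3 * π / n := by positivity
      linarith
    obtain ⟨X₁, _, _, _, _, _, _, h₁, D₁, G₁, hpg₁, hsh₁, htw₁, hseam₁, hbelt₁⟩ :=
      hmove g n X bX Ψ X (Diffeomorph.refl (𝓡∂ 4) X ∞) h D (fun k : Fin n => pageDir n ↑k) v s
        (fun k => norm_pageDir n k) hpage_k hshadow htw hseam0 hbelt0 ⟨i, hiA⟩ (-(3 * π / n))
        (some ⟨i + 1, hi⟩) hφ₁ hφ₁'
        (fun k hk0 hkc t ht heq => free_move1' hi k hk0 (fun c => hkc (by rw [c])) ht heq)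
        (fun k₁ hk₁ => by
          obtain rfl : (⟨i + 1, hi⟩ : Fin n) = k₁ := Option.some_injective _ hk₁
          exact ⟨hBA, 2 / 3, ⟨by norm_num, by norm_num⟩, cross_move1' hi⟩)
    have hd₁ : ∀ k, ‖Function.update (fun k : Fin n => pageDir n ↑k) ⟨i, hiA⟩ (pageDir n i * Complex.exp (((-(3 * π / n) : ℝ) : ℂ) * Complex.I)) k‖ = 1 := by
      intro k
      by_cases hk : k = ⟨i, hiA⟩
      · subst hk
        rw [Function.update_self, norm_mul, norm_pageDir, Complex.norm_exp_ofReal_mul_I, mul_one]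
      · rw [Function.update_of_ne hk, norm_pageDir]
    have hshadows₁ : ∀ k, shadow g (h₁ k).attachingCircle (h₁ k).continuous_attachingCircle = Function.update v ⟨i, hiA⟩ (transvection (stdSymp ℤ g) (v ⟨i + 1, hi⟩, !s ⟨i + 1, hi⟩) (v ⟨i, hiA⟩)) k := by
      intro k; rw [hsh₁ k]; simp only [Option.elim_some, if_neg hφ₁neg]
    -- MOVE 2: handle ⟨i + 1, hi⟩ rotated freely by `2 * π / n`
    have hφ₂ : (2 * π / n : ℝ) ≠ 0 := (by positivity : (0 : ℝ) < 2 * π / n).ne'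
    have hφ₂' : |(2 * π / n : ℝ)| < 2 * π := by
      rw [abs_of_pos (by positivity), div_lt_iff₀ hnpos]; nlinarith [Real.pi_pos, hn2r]
    obtain ⟨X₂, _, _, _, _, _, _, h₂, D₂, G₂, hpg₂, hsh₂, htw₂, hseam₂, hbelt₂⟩ :=
      hmove g n X bX Ψ X₁ ((Diffeomorph.refl (𝓡∂ 4) X ∞).trans G₁) h₁ D₁
        (Function.update (fun k : Fin n => pageDir n ↑k) ⟨i, hiA⟩ (pageDir n i * Complex.exp (((-(3 * π / n) : ℝ) : ℂ) * Complex.I))) (Function.update v ⟨i, hiA⟩ (transvection (stdSymp ℤ g) (v ⟨i + 1, hi⟩, !s ⟨i + 1, hi⟩) (v ⟨i, hiA⟩))) s hd₁ hpg₁ hshadows₁ htw₁ hseam₁ hbelt₁ ⟨i + 1, hi⟩ (2 * π / n) none hφ₂ hφ₂'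
        (fun k hk0 _ t ht heq => by
          rw [Function.update_of_ne hBA] at heq
          by_cases hk : k = ⟨i, hiA⟩
          · subst hk
            rw [Function.update_self] at heq
            exact free_move2_B' hi ht heq
          · rw [Function.update_of_ne hk] at heq
            exact free_move2_O' hi k hk hk0 ht heq)
        (fun k₁ hk₁ => (Option.some_ne_none k₁ hk₁.symm).elim)
    have hd₂ : ∀ k, ‖Function.update (Function.update (fun k : Fin n => pageDir n ↑k) ⟨i, hiA⟩ (pageDir n i * Complex.exp (((-(3 * π / n) : ℝ) : ℂ) * Complex.I))) ⟨i + 1, hi⟩ ((Function.update (fun k : Fin n => pageDir n ↑k) ⟨i, hiA⟩ (pageDir n i * Complex.exp (((-(3 * π / n) : ℝ) : ℂ) * Complex.I))) ⟨i + 1, hi⟩ * Complex.exp (((2 * π / n : ℝ) : ℂ) * Complex.I)) k‖ = 1 := by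
      intro k
      by_cases hk : k = ⟨i + 1, hi⟩
      · subst hk
        rw [Function.update_self, norm_mul, hd₁, Complex.norm_exp_ofReal_mul_I, mul_one]
      · rw [Function.update_of_ne hk]
        exact hd₁ k
    have hshadows₂ : ∀ k, shadow g (h₂ k).attachingCircle (h₂ k).continuous_attachingCircle = Function.update v ⟨i, hiA⟩ (transvection (stdSymp ℤ g) (v ⟨i + 1, hi⟩, !s ⟨i + 1, hi⟩) (v ⟨i, hiA⟩)) k := by
      intro k; rw [hsh₂ k, Option.elim_none, Function.update_eq_self]
    -- MOVE 3: handle ⟨i, hiA⟩ rotated freely by `π / n`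
    have hφ₃ : (π / n : ℝ) ≠ 0 := (by positivity : (0 : ℝ) < π / n).ne'
    have hφ₃' : |(π / n : ℝ)| < 2 * π := by
      rw [abs_of_pos (by positivity), div_lt_iff₀ hnpos]; nlinarith [Real.pi_pos, hn2r]
    obtain ⟨X₃, _, _, _, _, _, _, h₃, D₃, G₃, hpg₃, hsh₃, htw₃, hseam₃, -⟩ :=
      hmove g n X bX Ψ X₂ (((Diffeomorph.refl (𝓡∂ 4) X ∞).trans G₁).trans G₂) h₂ D₂
        (Function.update (Function.update (fun k : Fin n => pageDir n ↑k) ⟨i, hiA⟩ (pageDir n i * Complex.exp (((-(3 * π / n) : ℝ) : ℂ) * Complex.I))) ⟨i + 1, hi⟩ ((Function.update (fun k : Fin n => pageDir n ↑k) ⟨i, hiA⟩ (pageDir n i * Complex.exp (((-(3 * π / n) : ℝ) : ℂ) * Complex.I))) ⟨i + 1, hi⟩ * Complex.exp (((2 * π / n : ℝ) : ℂ) * Complex.I))) (Function.update v ⟨i, hiA⟩ (transvection (stdSymp ℤ g) (v ⟨i + 1, hi⟩, !s ⟨i + 1, hi⟩) (v ⟨i, hiA⟩))) s hd₂ hpg₂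 hshadows₂ htw₂ hseam₂ hbelt₂ ⟨i, hiA⟩ (π / n) none hφ₃ hφ₃'
        (fun k hk0 _ t ht heq => by
          rw [Function.update_of_ne hAB, Function.update_self] at heq
          by_cases hk : k = ⟨i + 1, hi⟩
          · subst hk
            rw [Function.update_self, Function.update_of_ne hBA] at heq
            exact free_move3_A' hi ht heq
          · rw [Function.update_of_ne hk, Function.update_of_ne hk0] at heq
            exact free_move3_O' hi k hk0 hk ht heq)
        (fun k₁ hk₁ => (Option.some_ne_none k₁ hk₁.symm).elim)
    -- OUTPUT
    refine ⟨X₃, ‹_›, ‹_›, ‹_›, ‹_›, ‹_›, ‹_›, h₃, D₃,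
      ((((Diffeomorph.refl (𝓡∂ 4) X ∞).trans G₁).trans G₂).trans G₃), ?_, ?_, ?_, ?_, ?_, ?_, htw₃, hseam₃⟩
    · intro k h1 h2 θ
      have hkA : k ≠ ⟨i, hiA⟩ := fun c => h1 (congrArg Fin.val c)
      have hkB : k ≠ ⟨i + 1, hi⟩ := fun c => h2 (congrArg Fin.val c)
      have hm := hpg₃ k θ
      rw [Function.update_of_ne hkA, Function.update_of_ne hkB, Function.update_of_ne hkA] at hm
      exact hm
    · intro θ
      have hm := hpg₃ ⟨i + 1, hi⟩ θ
      rw [Function.update_of_ne hBA, Function.update_self, Function.update_of_ne hBA] at hm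
      have e := dir_move2' hi
      exact e ▸ hm
    · intro θ
      have hm := hpg₃ ⟨i, hiA⟩ θ
      rw [Function.update_self, Function.update_of_ne hAB, Function.update_self, dir_move3' hi] at hm
      exact hm
    · intro k h1 h2
      have hkA : k ≠ ⟨i, hiA⟩ := fun c => h1 (congrArg Fin.val c)
      rw [hsh₃ k, Option.elim_none, Function.update_eq_self, Function.update_of_ne hkA]
    · rw [hsh₃, Option.elim_none, Function.update_eq_self, Function.update_of_ne hBA, if_neg Bool.false_ne_true]
    · rw [hsh₃, Option.elim_none, Function.update_eq_self, Function.update_self, if_neg Bool.false_ne_true]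

/-- **Turning one direction keeps unit directions**, registered form (sub-goal
`helper_norm_update_dir` of `stub_M2geo`): the direction bookkeeping of a drag. [folklore] -/
theorem helper_norm_update_dir : ∀ (n : ℕ) (d : Fin n → ℂ), (∀ k, ‖d k‖ = 1) → ∀ (k₀ : Fin n) (φ : ℝ) (k : Fin n), ‖Function.update d k₀ (d k₀ * Complex.exp ((φ : ℂ) * Complex.I)) k‖ = 1 := by
  intro n d hd k₀ φ k
  by_cases hk : k = k₀
  · subst hk; rw [Function.update_self, norm_mul, hd, Complex.norm_exp_ofReal_mul_I, mul_one]
  · rw [Function.update_of_ne hk]; exact hd k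

end Summit.SmoothPoincare4.SmoothPoincare4.Theorems.AcyclicBisectionExists.ModpBraidOrbits

end
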